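import Summits.BirchSwinnertonDyer.BirchSwinnertonDyer.Theorems.ClassRecordThreeCornerAtThreeWOfInputsR22
import Summits.BirchSwinnertonDyer.BirchSwinnertonDyer.Theorems.ClassRecordThreeCornerAtThreeR23ItemStatements
import Summits.BirchSwinnertonDyer.BirchSwinnertonDyer.Theses.ClassRecordThree
import Summits.BirchSwinnertonDyer.BirchSwinnertonDyer.Theses.KolyvaginRoadThree
import HarnessLib

/-!
# BC3 skeleton `Cruxes/CornerAtThreeW/Lines/inert.lean` — r23 (lane B g16): the ZERO-STUB END STATE of line `inert` on crux 21420 `CornerAtThreeW`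
# (19715 v17 ∕ 19109 r24 idiom; plan g43 RULING 80)

After RULING 80 (plan g43, 2026-08-28T21:08Z) every registered stub of r22 is a ROUTE ITEM of `ClassRecordThree` ∕ `KolyvaginRoadThree` (the six open
sub-goals filed as CHILDREN of `CornerAtThreeW`, bodies = lane B g16's `ITEMS-R23-turnkey.md`; the two bodies that lived inside the Theses cone restated
VERBATIM in the Theses-free module `…CornerAtThreeR23ItemStatements`, p668842, definitionally equal to the originals): `stub_cornerStepL3` = aside 19408
`CornerStepLLeafAtThree` · `stub_upper3_monoNamedFacts` = support 27981 `EulerHalfGrossPrintFacts` · `stub_upper3_inertDisplay` = aside 23177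
`ShimuraPrimitivesAtThreeInertFact` ∧ child `ShimuraPrimitivesAtThreeGuardedFact` ∧ child `CornerFHTwinLowerSupplyAtThree` · `stub_upper3_residualMulti` = child
`ShimuraPrimitivesWithSplitNormTDAtThree` · `stub_cornerTwinLowerModEight3` = child `CornerTwinLowerModEightAtThree` · `stub_cornerTwistMuAn3` = child
`CornerTwistMuAnAtThree` · `stub_cornerFacts3` = 19112 `PublishedInputsThree` ∧ child `KatoTwinFactsThreeOutside` ∧ 19524 `ShimuraParametrizationDataNonempty` ∧ 19716
`PastenComponentOrdersInput` ∧ 19526 `ShimuraCurveGrossZagierKolyvagin` (the Cai–Shu–Tian GZ part by projection); CLOSED 20191 is read from its kernel theorem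
inside the closer. So the line has NO stub left: `CornerAtThreeW_of` (CR3) ∕ `CornerAtThreeW_of'` (KR3) bind THIRTEEN route items BY NAME and nothing else — its proof is lane B g16's landed
closer `CornerAtThreeWOfInputs.cornerAtThreeW_of_itemsR22K` (`Theorems/ClassRecordThreeCornerAtThreeWOfInputsR22.lean`, p665549 + p667259: (U) through the
SHARPENED converse bridge (A′) p662111 — the twin's KATO half only; (W) from the mod-8 witness p663448; the mono ∕ inert ∕ anchor (U)-machine of lanes A/B
g0–g15 unchanged). 0 `sorry`. What is OPEN is now entirely on the route: beyond print — 19408 (L) STEP L on the ¬Surj frames [IMC-grade], the children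
`CornerTwistMuAnAtThree` (analytic μ = 0 of the odd Heegner twins, ∀; per-pair certified), `CornerTwinLowerModEightAtThree` (ONE mod-8 ≥-half per curve, odd N
only = 61 ∕ 296 census pairs, 61 ∕ 61 certified), `CornerFHTwinLowerSupplyAtThree` (the Friedberg–Hoffstein twin-lower supply; 824 ∕ 824 certified);
print — 19112, 27981, 19524, 19716, 19526, 23177 and the children `KatoTwinFactsThreeOutside`, `ShimuraPrimitivesAtThreeGuardedFact`,
`ShimuraPrimitivesWithSplitNormTDAtThree`. STRENGTH of the crux itself: lane B g16's certificates `…CornerAtThreeWStrength` (21420 ⟺ 19111 modulo print;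
the (α)-residual) and `…CornerAtThreeOneFrame` (the consumer needs ONE frame). History r1–r22: the r22 file (`HOME/corner3/g16/inertW_r22.lean`
7d82f1ce6c219ecf) and its history blocks. Nothing is asserted about any curve (T7); BSD is proved for no curve.
-/

set_option linter.dupNamespace false
set_option autoImplicit false

noncomputable section

namespace Summit.BirchSwinnertonDyer.BirchSwinnertonDyer.Cruxes.CornerAtThreeW.Inert

/-- **Crux 21420 `CornerAtThreeW` BY NAME from its THIRTEEN route items BY NAME — r23, zero stubs** (see the module docstring for the ledger of inputs;
proof = the landed closer `CornerAtThreeWOfInputs.cornerAtThreeW_of_itemsR22K`, the two Theses-free restated bodies passed by definitional unfolding).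
CONDITIONAL on the thirteen items; nothing booked. [cite: JetchevSkinnerWan2017, §7.4.1–§7.4.2] [cite: GrossLMS1991, Prop. 3.7 (2), §6]
[cite: Darmon2004, Prop. 3.10, Def. 3.12, Thm. 4.18] [cite: Kato2004Asterisque, §17.13] [cite: HoffsteinLuo1997, Theorem (§1)] -/
theorem CornerAtThreeW_of
    (hP : Summit.BirchSwinnertonDyer.BirchSwinnertonDyer.Theses.ClassRecordThree.PublishedInputsThree)
    (hJL : Summit.BirchSwinnertonDyer.BirchSwinnertonDyer.Theses.ClassRecordThree.ShimuraParametrizationDataNonempty)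
    (hF2 : Summit.BirchSwinnertonDyer.BirchSwinnertonDyer.Theses.ClassRecordThree.EulerHalfGrossPrintFacts)
    (hS : Summit.BirchSwinnertonDyer.BirchSwinnertonDyer.Theses.ClassRecordThree.CornerStepLLeafAtThree)
    (hCO : Summit.BirchSwinnertonDyer.BirchSwinnertonDyer.Theses.ClassRecordThree.PastenComponentOrdersInput)
    (hPrim : Summit.BirchSwinnertonDyer.BirchSwinnertonDyer.Theses.ClassRecordThree.ShimuraPrimitivesAtThreeInertFact)
    (hGZK : Summit.BirchSwinnertonDyer.BirchSwinnertonDyer.Theses.ClassRecordThree.ShimuraCurveGrossZagierKolyvagin)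
    -- the six RULING 80 children of `CornerAtThreeW` (RULING 80 (c)/(d): items 23542 · 23543 · 23538 · 23539 · 23541 · 23540; CR3 rev 43, KR3 rev 41)
    (hT8 : Summit.BirchSwinnertonDyer.BirchSwinnertonDyer.Theses.ClassRecordThree.CornerTwinLowerModEightAtThree)
    (hμ : Summit.BirchSwinnertonDyer.BirchSwinnertonDyer.Theses.ClassRecordThree.CornerTwistMuAnAtThree)
    (hKato8 : Summit.BirchSwinnertonDyer.BirchSwinnertonDyer.Theses.ClassRecordThree.KatoTwinFactsThreeOutside)
    (hPrimG : Summit.BirchSwinnertonDyer.BirchSwinnertonDyer.Theses.ClassRecordThree.ShimuraPrimitivesAtThreeGuardedFact)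
    (hTL3 : Summit.BirchSwinnertonDyer.BirchSwinnertonDyer.Theses.ClassRecordThree.CornerFHTwinLowerSupplyAtThree)
    (hres : Summit.BirchSwinnertonDyer.BirchSwinnertonDyer.Theses.ClassRecordThree.ShimuraPrimitivesWithSplitNormTDAtThree) :
    Summit.BirchSwinnertonDyer.BirchSwinnertonDyer.Theses.ClassRecordThree.CornerAtThreeW :=
  Summit.BirchSwinnertonDyer.BirchSwinnertonDyer.Theorems.CornerAtThreeWOfInputs.cornerAtThreeW_of_itemsR22K
    hP hJL hF2 hS hCO hPrim hGZK hT8 hμ hKato8 hPrimG hTL3 hres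

/-- **The `KolyvaginRoadThree` twin `CornerAtThreeW_of'` — r23, zero stubs** (19109 r24 idiom; KR3 item names — the six children DEDUPED to the same items
23538–23543, KR3 rev 41; `PublishedInputsThree` is CR3's, as in every r16–r22 twin). -/
theorem CornerAtThreeW_of'
    (hP : Summit.BirchSwinnertonDyer.BirchSwinnertonDyer.Theses.ClassRecordThree.PublishedInputsThree)
    (hJL : Summit.BirchSwinnertonDyer.BirchSwinnertonDyer.Theses.KolyvaginRoadThree.ShimuraParametrizationDataNonempty)
    (hF2 : Summit.BirchSwinnertonDyer.BirchSwinnertonDyer.Theses.KolyvaginRoadThree.EulerHalfGrossPrintFacts)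
    (hS : Summit.BirchSwinnertonDyer.BirchSwinnertonDyer.Theses.KolyvaginRoadThree.CornerStepLLeafAtThree)
    (hCO : Summit.BirchSwinnertonDyer.BirchSwinnertonDyer.Theses.KolyvaginRoadThree.PastenComponentOrdersInput)
    (hPrim : Summit.BirchSwinnertonDyer.BirchSwinnertonDyer.Theses.KolyvaginRoadThree.ShimuraPrimitivesAtThreeInertFact)
    (hGZK : Summit.BirchSwinnertonDyer.BirchSwinnertonDyer.Theses.KolyvaginRoadThree.ShimuraCurveGrossZagierKolyvagin)
    (hT8 : Summit.BirchSwinnertonDyer.BirchSwinnertonDyer.Theses.KolyvaginRoadThree.CornerTwinLowerModEightAtThree)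
    (hμ : Summit.BirchSwinnertonDyer.BirchSwinnertonDyer.Theses.KolyvaginRoadThree.CornerTwistMuAnAtThree)
    (hKato8 : Summit.BirchSwinnertonDyer.BirchSwinnertonDyer.Theses.KolyvaginRoadThree.KatoTwinFactsThreeOutside)
    (hPrimG : Summit.BirchSwinnertonDyer.BirchSwinnertonDyer.Theses.KolyvaginRoadThree.ShimuraPrimitivesAtThreeGuardedFact)
    (hTL3 : Summit.BirchSwinnertonDyer.BirchSwinnertonDyer.Theses.KolyvaginRoadThree.CornerFHTwinLowerSupplyAtThree)
    (hres : Summit.BirchSwinnertonDyer.BirchSwinnertonDyer.Theses.KolyvaginRoadThree.ShimuraPrimitivesWithSplitNormTDAtThree) :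
    Summit.BirchSwinnertonDyer.BirchSwinnertonDyer.Theses.KolyvaginRoadThree.CornerAtThreeW :=
  Summit.BirchSwinnertonDyer.BirchSwinnertonDyer.Theorems.CornerAtThreeWOfInputs.kolyvaginRoadThree_cornerAtThreeW_of_itemsR22K
    hP hJL hF2 hS hCO hPrim hGZK hT8 hμ hKato8 hPrimG hTL3 hres

end Summit.BirchSwinnertonDyer.BirchSwinnertonDyer.Cruxes.CornerAtThreeW.Inert

end
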